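import Summits.QuantumFields.YangMills.Theorems.SwapVirialDeficitSwapRingCommBox
import Summits.QuantumFields.YangMills.Theorems.SwapTwistDeficitPeriodicRingFloorLeaderEvent
import HarnessLib

/-!
# The product-Haar MASS of the σ-twisted nearly-commuting box of the σ-glued ring with an ARBITRARY measurable leader event:
# `Haar⁴(E)·ballVol(t₂)^{6L⁴−3} ≤ μ_L{F^S_0 ≤ 300L⁴(t₂+s)²}`
# (brick (α2-iv) of LEAD ym-line-sfw-p2 g93's fixed-`L` programme for `TT.twistTrace L β (2L)`; free-hands support of item stmt-QuantumFields-24197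
# `SwapVirialDeficit.SwapGluedStiffness`)

The σ-twin of ✓`PeriodicRingFloor.pi_real_mul_ballVol_pow_le_ringMeasure_real_deficit_le`: the same tree-gauge host, letter translations and leader identification
`Fin.snoc (μ ↦ w(−ê_μ,μ)) (g 0) : Fin 4 → SU(2)` (✓`measure_leaderSet_eq`), with the leader event now inside the σ-TWISTED nearly-commuting quadruples
(`‖C_μC_ν − C_νC_μ‖_F ≤ s` for `μ, ν < 3`, `‖C₃·C_{σμ} − C_μ·C₃‖_F ≤ s`, `σ = swap 0 1`) and the deficit bound ✓`swapRingDeficit_le_of_commBox`, the transfer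
✓`measureReal_swapDeficit_le_eq_fix`.  With a volume floor `≳ s⁷` for that event (three nearly commuting letters `s⁴` — the swap-central cone of commuting triples —
times the slaved letter `C₁ ≈ c⁻¹C₀c`, `s³`) this gives the log-free floor `c_L·e^{12βL⁴}·β^{−(9L⁴−1)} ≤ TT.twistTrace L β (2L)` (sequel).

* ★ `pi_real_mul_ballVol_pow_le_ringMeasure_real_swapDeficit_le`.

HONEST FRAMING: fixed-lattice Haar-measure bookkeeping; ⟨24197⟩, ⟨24194⟩ and every rung stay OPEN; the Yang–Mills mass gap is NOT proved; no summit is proved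
by a line.  THEOREMS ONLY (0 `def`, 0 `sorry`), standard axioms.  Width seat ym-line-sfw-p2-w3 g61 (cell ym-idea-1, free hands), `--supports stmt-QuantumFields-24197`.
References: [cite: Chatterjee2016, Lemma 9.3]; [cite: Luscher1983, §2]; [cite: tHooft1979].
-/

set_option autoImplicit false

noncomputable section

open MeasureTheory
open scoped BigOperators ENNReal
open Literature.MathematicalPhysics.QuantumFieldTheory hiding SU2
open Literature.MathematicalPhysics.QuantumLattice

namespace Summit.QuantumFields.YangMills.Theorems.SwapVirialDeficit.SwapRing

open Summit.QuantumFields.YangMills.Theorems.FemtoTransferGap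
open Summit.QuantumFields.YangMills.Theorems.FemtoTransferGap.TT
open Summit.QuantumFields.YangMills.Theorems.VirialFluxGap.RingDeficit
open Summit.QuantumFields.YangMills.Theorems.VirialFluxGap.FixSplit (card_offIdx)
open Summit.QuantumFields.YangMills.Theorems.SwapTwistDeficit.PeriodicRingFloor

variable {L : ℕ} [NeZero L]

/-- ★ **HAAR⁴(E) · ballVol(t₂)^{6L⁴−3} ≤ μ_L{F^S_0 ≤ 300·L⁴·(t₂+s)²} FOR EVERY MEASURABLE LEADER EVENT `E` OF σ-TWISTED NEARLY COMMUTING QUADRUPLES.**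
For `0 ≤ t₂, s` and measurable `E` inside the σ-twisted nearly-commuting quadruples (`C₃ = c` the seam letter: `‖C_μC_ν − C_νC_μ‖_F ≤ s` for
`μ, ν < 3` and `‖c·C_{σμ} − C_μ·c‖_F ≤ s`, `σ = swap 0 1`): the tree-gauged ring histories whose leaders `Fin.snoc (μ ↦ w(−ê_μ,μ)) (g 0)` lie in `E` and
whose other `6L⁴ − 3` variables are within `t₂` of their letters have product-Haar mass `Haar⁴(E)·ballVol(t₂)^{6L⁴−3}` (✓`measure_leaderSet_eq`, the
architecture of ✓`pi_real_mul_ballVol_pow_le_ringMeasure_real_deficit_le`) and lie in `{F^S_0 ≤ 300L⁴(t₂+s)²}` by ✓`swapRingDeficit_le_of_commBox`; tree gauge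
✓`measureReal_swapDeficit_le_eq_fix`. [cite: Chatterjee2016, Lemma 9.3] [cite: Luscher1983, §2] [cite: tHooft1979] -/
theorem pi_real_mul_ballVol_pow_le_ringMeasure_real_swapDeficit_le {t₂ s : ℝ} (ht₂ : 0 ≤ t₂) (hs : 0 ≤ s)
    (E : Set (Fin 4 → SU2)) (hEm : MeasurableSet E)
    (hE : E ⊆ {C : Fin 4 → SU2 |
      (∀ μ ν : Fin 3, frobNorm (((C (Fin.castSucc μ) * C (Fin.castSucc ν) : SU2) : Matrix (Fin 2) (Fin 2) ℂ) -
        ((C (Fin.castSucc ν) * C (Fin.castSucc μ) : SU2) : Matrix (Fin 2) (Fin 2) ℂ)) ≤ s) ∧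
      ∀ μ : Fin 3, frobNorm (((C (Fin.last 3) * C (Fin.castSucc (Equiv.swap (0 : Fin 3) 1 μ)) : SU2) : Matrix (Fin 2) (Fin 2) ℂ) -
        ((C (Fin.castSucc μ) * C (Fin.last 3) : SU2) : Matrix (Fin 2) (Fin 2) ℂ)) ≤ s}) :
    (Measure.pi fun _ : Fin 4 => haarProbability SU2).real E * ballVol t₂ ^ (6 * L ^ 4 - 3) ≤
      (ringMeasure L).real {P | swapRingDeficit L (fun _ => false) P ≤ 300 * (L : ℝ) ^ 4 * (t₂ + s) ^ 2} := by
  haveI : (haarProbability SU2).IsMulLeftInvariant := by unfold haarProbability; infer_instance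
  haveI : IsProbabilityMeasure (gaugeMeasure L) := isProbabilityMeasure_gaugeMeasure (L := L)
  -- the three factors of `X_fix` and their measures
  set μA : Measure (OffIdx L → SU2) := Measure.pi fun _ : OffIdx L => haarProbability SU2 with hμA
  set μB : Measure (Fin (2 * L - 1) → GaugeConfig 3 L SU2) := Measure.pi fun _ : Fin (2 * L - 1) => configMeasure SU2 L with hμB
  set μC : Measure (Site 3 L → SU2) := gaugeMeasure L with hμC
  set π4 : Measure (Fin 4 → SU2) := Measure.pi fun _ : Fin 4 => haarProbability SU2 with hπ4
  -- the fluctuation ball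
  set B₂ : Set SU2 := {W : SU2 | frobNorm ((W : Matrix (Fin 2) (Fin 2) ℂ) - 1) ≤ t₂} with hB₂
  have hB₂m : MeasurableSet B₂ := measurableSet_frobBall_one t₂
  /- (A) slice 0: leaders and letters -/
  set Lead : Fin 3 → OffIdx L := fun μ => ⟨(Pi.single μ (-1 : ZMod L), μ), leader_not_treeEdge μ⟩ with hLead
  have hLead_inj : Function.Injective Lead := fun μ ν h => by
    have := congrArg (fun i : OffIdx L => i.1.2) h
    simpa [hLead] using this
  set pA : OffIdx L → Prop := fun i => ∃ μ, i = Lead μ with hpA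
  set πA₁ : Measure ({i // pA i} → SU2) := Measure.pi fun _ => haarProbability SU2 with hπA₁
  set πA₂ : Measure ({i // ¬pA i} → SU2) := Measure.pi fun _ => haarProbability SU2 with hπA₂
  set eA := MeasurableEquiv.piEquivPiSubtypeProd (fun _ : OffIdx L => SU2) pA with heA_def
  have heA : MeasurePreserving eA μA (πA₁.prod πA₂) := measurePreserving_piEquivPiSubtypeProd (fun _ : OffIdx L => haarProbability SU2) pA
  set cA : ({i // pA i} → SU2) → OffIdx L → SU2 := fun a i =>
    (if i.1.1 i.1.2 = -1 then a ⟨Lead i.1.2, ⟨i.1.2, rfl⟩⟩ else 1)⁻¹ with hcA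
  set ΦA : ({i // pA i} → SU2) → ({i // ¬pA i} → SU2) → ({i // ¬pA i} → SU2) := fun a b i => cA a i.1 * b i with hΦA
  have hΦAa : ∀ a, MeasurePreserving (ΦA a) πA₂ πA₂ := fun a =>
    measurePreserving_pi (fun _ : {i // ¬pA i} => haarProbability SU2) (fun _ : {i // ¬pA i} => haarProbability SU2)
      fun i => measurePreserving_mul_left (haarProbability SU2) (cA a i.1)
  have hcAm : ∀ i : OffIdx L, Measurable fun a : {i // pA i} → SU2 => cA a i := by
    intro i
    by_cases hsx : i.1.1 i.1.2 = -1
    · simp only [hcA, hsx, if_true]; exact (measurable_pi_apply _).inv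
    · simp only [hcA, hsx, if_false, inv_one]; exact measurable_const
  have hΦAm : Measurable (Function.uncurry ΦA) := by
    refine measurable_pi_lambda _ fun i => ?_
    exact ((hcAm i.1).comp measurable_fst).mul ((measurable_pi_apply i).comp measurable_snd)
  set skA : ({i // pA i} → SU2) × ({i // ¬pA i} → SU2) → ({i // pA i} → SU2) × ({i // ¬pA i} → SU2) :=
    fun z => (id z.1, ΦA z.1 z.2) with hskA
  have hskewA : MeasurePreserving skA (πA₁.prod πA₂) (πA₁.prod πA₂) :=
    (MeasurePreserving.id πA₁).skew_product hΦAm (ae_of_all _ fun a => (hΦAa a).map_eq)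
  have hψA : MeasurePreserving (fun w => skA (eA w)) μA (πA₁.prod πA₂) := hskewA.comp heA
  /- (C) the seam field: leader `g 0` (an opaque copy of the predicate `x = 0`, so that `{x // pC x}` carries the generic instances) -/
  obtain ⟨pC, hpC⟩ : ∃ p : Site 3 L → Prop, ∀ x, p x ↔ x = 0 := ⟨fun x => x = 0, fun _ => Iff.rfl⟩
  haveI hdecC : DecidablePred pC := fun x => decidable_of_iff _ (hpC x).symm
  have hp0 : pC 0 := (hpC 0).2 rfl
  set πC₁ : Measure ({x // pC x} → SU2) := Measure.pi fun _ => haarProbability SU2 with hπC₁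
  set πC₂ : Measure ({x // ¬pC x} → SU2) := Measure.pi fun _ => haarProbability SU2 with hπC₂
  set eC := MeasurableEquiv.piEquivPiSubtypeProd (fun _ : Site 3 L => SU2) pC with heC_def
  have heC : MeasurePreserving eC μC (πC₁.prod πC₂) := by
    have hμC' : μC = Measure.pi fun _ : Site 3 L => haarProbability SU2 := rfl
    rw [hμC']
    exact measurePreserving_piEquivPiSubtypeProd (fun _ : Site 3 L => haarProbability SU2) pC
  set ΦC : ({x // pC x} → SU2) → ({x // ¬pC x} → SU2) → ({x // ¬pC x} → SU2) := fun a b x => (a ⟨0, hp0⟩)⁻¹ * b x with hΦC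
  have hΦCa : ∀ a, MeasurePreserving (ΦC a) πC₂ πC₂ := fun a =>
    measurePreserving_pi (fun _ : {x // ¬pC x} => haarProbability SU2) (fun _ : {x // ¬pC x} => haarProbability SU2)
      fun _ => measurePreserving_mul_left (haarProbability SU2) _
  have hΦCm : Measurable (Function.uncurry ΦC) := by
    refine measurable_pi_lambda _ fun x => ?_
    exact ((measurable_pi_apply _).inv.comp measurable_fst).mul ((measurable_pi_apply x).comp measurable_snd)
  set skC : ({x // pC x} → SU2) × ({x // ¬pC x} → SU2) → ({x // pC x} → SU2) × ({x // ¬pC x} → SU2) :=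
    fun z => (id z.1, ΦC z.1 z.2) with hskC
  have hskewC : MeasurePreserving skC (πC₁.prod πC₂) (πC₁.prod πC₂) :=
    (MeasurePreserving.id πC₁).skew_product hΦCm (ae_of_all _ fun a => (hΦCa a).map_eq)
  have hψC : MeasurePreserving (fun g => skC (eC g)) μC (πC₁.prod πC₂) := hskewC.comp heC
  /- (B) the slices `1 … 2L−1`, translated by `glue w` -/
  set τ : (OffIdx L → SU2) → (Fin (2 * L - 1) → GaugeConfig 3 L SU2) → (Fin (2 * L - 1) → GaugeConfig 3 L SU2) :=
    fun w r j e => (glue w e)⁻¹ * r j e with hτ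
  have hτw : ∀ w, MeasurePreserving (τ w) μB μB := fun w => by
    have hin : MeasurePreserving (fun (U : GaugeConfig 3 L SU2) (e : Edge 3 L) => (glue w e)⁻¹ * U e)
        (configMeasure SU2 L) (configMeasure SU2 L) := by
      unfold configMeasure
      exact measurePreserving_pi (fun _ : Edge 3 L => haarProbability SU2) (fun _ : Edge 3 L => haarProbability SU2)
        fun e => measurePreserving_mul_left (haarProbability SU2) ((glue w e)⁻¹)
    exact measurePreserving_pi (fun _ : Fin (2 * L - 1) => configMeasure SU2 L) (fun _ : Fin (2 * L - 1) => configMeasure SU2 L)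
      fun _ => hin
  set Ψ₁ : (OffIdx L → SU2) × ((Fin (2 * L - 1) → GaugeConfig 3 L SU2) × (Site 3 L → SU2)) →
      (OffIdx L → SU2) × ((Fin (2 * L - 1) → GaugeConfig 3 L SU2) × (Site 3 L → SU2)) :=
    fun x => (id x.1, (τ x.1 x.2.1, x.2.2)) with hΨ₁
  have hfibm : Measurable (Function.uncurry fun (w : OffIdx L → SU2)
      (q : (Fin (2 * L - 1) → GaugeConfig 3 L SU2) × (Site 3 L → SU2)) => (τ w q.1, q.2)) := by
    refine Measurable.prodMk ?_ (measurable_snd.comp measurable_snd)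
    refine measurable_pi_lambda _ fun j => measurable_pi_lambda _ fun e => ?_
    exact (((measurable_pi_apply e).comp (measurable_glue.comp measurable_fst)).inv).mul
      ((measurable_pi_apply e).comp ((measurable_pi_apply j).comp (measurable_fst.comp measurable_snd)))
  have hfib : ∀ w, MeasurePreserving (fun q : (Fin (2 * L - 1) → GaugeConfig 3 L SU2) × (Site 3 L → SU2) => (τ w q.1, q.2))
      (μB.prod μC) (μB.prod μC) := fun w => (hτw w).prod (MeasurePreserving.id μC)
  have hΨ₁m : MeasurePreserving Ψ₁ (μA.prod (μB.prod μC)) (μA.prod (μB.prod μC)) :=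
    (MeasurePreserving.id μA).skew_product hfibm (ae_of_all _ fun w => (hfib w).map_eq)
  set Ψ₂ : (OffIdx L → SU2) × ((Fin (2 * L - 1) → GaugeConfig 3 L SU2) × (Site 3 L → SU2)) →
      (({i // pA i} → SU2) × ({i // ¬pA i} → SU2)) ×
        ((Fin (2 * L - 1) → GaugeConfig 3 L SU2) × (({x // pC x} → SU2) × ({x // ¬pC x} → SU2))) :=
    Prod.map (fun w => skA (eA w)) (Prod.map id fun g => skC (eC g)) with hΨ₂
  have hΨ₂m : MeasurePreserving Ψ₂ (μA.prod (μB.prod μC)) ((πA₁.prod πA₂).prod (μB.prod (πC₁.prod πC₂))) :=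
    hψA.prod ((MeasurePreserving.id μB).prod hψC)
  have hΨ : MeasurePreserving (fun x => Ψ₂ (Ψ₁ x)) (μA.prod (μB.prod μC)) ((πA₁.prod πA₂).prod (μB.prod (πC₁.prod πC₂))) :=
    hΨ₂m.comp hΨ₁m
  /- (Θ) the two leader factors as one point of `Fin 4 → SU(2)` -/
  set e3 : Fin 3 ≃ {i // pA i} := Equiv.ofBijective (fun μ => ⟨Lead μ, ⟨μ, rfl⟩⟩)
    ⟨fun μ ν h => hLead_inj (congrArg Subtype.val h), fun i => by
      obtain ⟨μ, hμ⟩ := i.2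
      exact ⟨μ, Subtype.ext hμ.symm⟩⟩ with he3
  set eA1 : ({i // pA i} → SU2) ≃ᵐ (Fin 3 → SU2) := (MeasurableEquiv.piCongrLeft (fun _ : {i // pA i} => SU2) e3).symm with heA1
  have hA1 : MeasurePreserving eA1 πA₁ (Measure.pi fun _ : Fin 3 => haarProbability SU2) :=
    MeasurePreserving.symm _ (measurePreserving_piCongrLeft (fun _ : {i // pA i} => haarProbability SU2) e3)
  set eC1 : ({x // pC x} → SU2) → SU2 := fun a => a ⟨0, hp0⟩ with heC1
  have hC1 : MeasurePreserving eC1 πC₁ (haarProbability SU2) :=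
    measurePreserving_eval (fun _ : {x // pC x} => haarProbability SU2) ⟨0, hp0⟩
  set e4 := MeasurableEquiv.piFinSuccAbove (fun _ : Fin 4 => SU2) (Fin.last 3) with he4
  have h4 : MeasurePreserving e4 π4 ((haarProbability SU2).prod (Measure.pi fun _ : Fin 3 => haarProbability SU2)) :=
    measurePreserving_piFinSuccAbove (fun _ : Fin 4 => haarProbability SU2) (Fin.last 3)
  set Θ : ({i // pA i} → SU2) × ({x // pC x} → SU2) → (Fin 4 → SU2) :=
    fun z => e4.symm (Prod.map eC1 eA1 (Prod.swap z)) with hΘ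
  have hΘm : MeasurePreserving Θ (πA₁.prod πC₁) π4 :=
    ((MeasurePreserving.symm e4 h4).comp (hC1.prod hA1)).comp Measure.measurePreserving_swap
  have hΘ_cast : ∀ (z : ({i // pA i} → SU2) × ({x // pC x} → SU2)) (μ : Fin 3),
      Θ z (Fin.castSucc μ) = z.1 ⟨Lead μ, ⟨μ, rfl⟩⟩ := by
    intro z μ
    simp only [hΘ, he4, heC1, heA1, Prod.map, Prod.swap, MeasurableEquiv.piFinSuccAbove_symm_apply, Fin.insertNthEquiv_apply,
      Fin.insertNth_last', Fin.snoc_castSucc]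
    rfl
  have hΘ_last : ∀ (z : ({i // pA i} → SU2) × ({x // pC x} → SU2)), Θ z (Fin.last 3) = z.2 ⟨0, hp0⟩ := by
    intro z
    simp only [hΘ, he4, heC1, Prod.map, Prod.swap, MeasurableEquiv.piFinSuccAbove_symm_apply, Fin.insertNthEquiv_apply,
      Fin.insertNth_last', Fin.snoc_last]
  /- the target set and the toron event -/
  set F : Set (({i // pA i} → SU2) × ({x // pC x} → SU2)) := Θ ⁻¹' E with hF
  have hFm : MeasurableSet F := hEm.preimage hΘm.measurable
  set SA : Set ({i // ¬pA i} → SU2) := Set.pi Set.univ fun _ => B₂ with hSA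
  set SB : Set (Fin (2 * L - 1) → GaugeConfig 3 L SU2) := Set.pi Set.univ fun _ => Set.pi Set.univ fun _ => B₂ with hSB
  set SC : Set ({x // ¬pC x} → SU2) := Set.pi Set.univ fun _ => B₂ with hSC
  have hSAm : MeasurableSet SA := MeasurableSet.univ_pi fun _ => hB₂m
  have hSBm : MeasurableSet SB := MeasurableSet.univ_pi fun _ => MeasurableSet.univ_pi fun _ => hB₂m
  have hSCm : MeasurableSet SC := MeasurableSet.univ_pi fun _ => hB₂m
  set T : Set ((({i // pA i} → SU2) × ({i // ¬pA i} → SU2)) ×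
      ((Fin (2 * L - 1) → GaugeConfig 3 L SU2) × (({x // pC x} → SU2) × ({x // ¬pC x} → SU2)))) :=
    {z | (z.1.1, z.2.2.1) ∈ F ∧ z.1.2 ∈ SA ∧ z.2.1 ∈ SB ∧ z.2.2.2 ∈ SC} with hT
  have hTm : MeasurableSet T := by
    have h1 : Measurable fun z : (({i // pA i} → SU2) × ({i // ¬pA i} → SU2)) ×
        ((Fin (2 * L - 1) → GaugeConfig 3 L SU2) × (({x // pC x} → SU2) × ({x // ¬pC x} → SU2))) => (z.1.1, z.2.2.1) :=
      measurable_fst.fst.prodMk measurable_snd.snd.fst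
    exact ((hFm.preimage h1).inter (hSAm.preimage measurable_fst.snd)).inter
      ((hSBm.preimage measurable_snd.fst).inter (hSCm.preimage measurable_snd.snd.snd)) |>.congr
      (by ext z; simp only [hT, Set.mem_inter_iff, Set.mem_preimage, Set.mem_setOf_eq, and_assoc])
  set P : Set ((OffIdx L → SU2) × ((Fin (2 * L - 1) → GaugeConfig 3 L SU2) × (Site 3 L → SU2))) :=
    (fun x => Ψ₂ (Ψ₁ x)) ⁻¹' T with hP
  /- (1) the mass of the toron event -/
  have hcardA₁ : Fintype.card {i // pA i} = 3 := by
    have hmem : ∀ i : OffIdx L, i ∈ Finset.univ.image Lead ↔ pA i := fun i => by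
      simp only [Finset.mem_image, Finset.mem_univ, true_and]
      constructor
      · rintro ⟨μ, h⟩; exact ⟨μ, h.symm⟩
      · rintro ⟨μ, h⟩; exact ⟨μ, h.symm⟩
    rw [Fintype.card_of_subtype (Finset.univ.image Lead) hmem, Finset.card_image_of_injective _ hLead_inj, Finset.card_univ,
      Fintype.card_fin]
  have hcardA₂ : Fintype.card {i // ¬pA i} = 2 * L ^ 3 + 1 - 3 := by
    rw [Fintype.card_subtype_compl, hcardA₁, card_offIdx]
  have hcardC₁ : Fintype.card {x // pC x} = 1 := by
    rw [Fintype.card_of_subtype ({0} : Finset (Site 3 L)) (fun x => by rw [Finset.mem_singleton]; exact (hpC x).symm),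
      Finset.card_singleton]
  have hcardC₂ : Fintype.card {x // ¬pC x} = L ^ 3 - 1 := by
    rw [Fintype.card_subtype_compl, hcardC₁, TwoLattice.Electric.card_site]
  have hSBmass : μB SB = (haarProbability SU2 B₂ ^ Fintype.card (Edge 3 L)) ^ (2 * L - 1) := by
    rw [hμB, hSB, Measure.pi_pi]
    simp only [configMeasure, Measure.pi_pi, Finset.prod_const, Finset.card_univ, Fintype.card_fin]
  have hPmass : (μA.prod (μB.prod μC)) P = π4 E * haarProbability SU2 B₂ ^ (6 * L ^ 4 - 3) := by
    have h1 : (μA.prod (μB.prod μC)) P = ((πA₁.prod πA₂).prod (μB.prod (πC₁.prod πC₂))) T :=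
      hΨ.measure_preimage hTm.nullMeasurableSet
    have h2 : (πA₁.prod πC₁) F = π4 E := hΘm.measure_preimage hEm.nullMeasurableSet
    rw [h1, hT, measure_leaderSet_eq πA₁ πA₂ μB πC₁ πC₂ hFm hSAm hSBm hSCm, h2, hSBmass, hSA, hSC, hπA₂, hπC₂, Measure.pi_pi,
      Measure.pi_pi]
    simp only [Finset.prod_const, Finset.card_univ, hcardA₂, hcardC₂, FemtoTransferGap.card_edge_three]
    rw [← card_nonleaders (L := L) NeZero.one_le]
    ring
  /- (2) on the toron event the deficit is small -/
  have hPsub : P ⊆ {x | swapRingDeficit L (fun _ => false)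
      ((Fin.cons (glue x.1) x.2.1 : Fin (2 * L - 1 + 1) → GaugeConfig 3 L SU2), x.2.2) ≤ 300 * (L : ℝ) ^ 4 * (t₂ + s) ^ 2} := by
    rintro ⟨w, r, g⟩ hx
    have hx' : Ψ₂ (Ψ₁ (w, r, g)) ∈ T := hx
    simp only [hT, hΨ₂, hΨ₁, Prod.map_apply, id, Set.mem_setOf_eq] at hx'
    obtain ⟨hFx, hAR, hBx, hCR⟩ := hx'
    -- the leaders: membership in `E`
    have hlead4 := hE hFx
    simp only [Set.mem_setOf_eq] at hlead4
    have hleadA : ∀ μ : Fin 3, Θ ((skA (eA w)).1, (skC (eC g)).1) (Fin.castSucc μ) = w (Lead μ) := fun μ => by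
      rw [hΘ_cast]; rfl
    have hleadC : Θ ((skA (eA w)).1, (skC (eC g)).1) (Fin.last 3) = g 0 := by
      rw [hΘ_last]; rfl
    have hCC : ∀ μ ν : Fin 3, frobNorm (((w (Lead μ) * w (Lead ν) : SU2) : Matrix (Fin 2) (Fin 2) ℂ) -
        ((w (Lead ν) * w (Lead μ) : SU2) : Matrix (Fin 2) (Fin 2) ℂ)) ≤ s := fun μ ν => by
      have h := hlead4.1 μ ν
      rwa [hleadA, hleadA] at h
    have hcC : ∀ μ : Fin 3, frobNorm (((g 0 * w (Lead (Equiv.swap (0 : Fin 3) 1 μ)) : SU2) : Matrix (Fin 2) (Fin 2) ℂ) -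
        ((w (Lead μ) * g 0 : SU2) : Matrix (Fin 2) (Fin 2) ℂ)) ≤ s := fun μ => by
      have h := hlead4.2 μ
      rwa [hleadA, hleadA, hleadC] at h
    -- letters of slice 0
    have hw : ∀ i : OffIdx L, frobNorm ((((if i.1.1 i.1.2 = -1 then w (Lead i.1.2) else 1)⁻¹ * w i : SU2) :
        Matrix (Fin 2) (Fin 2) ℂ) - 1) ≤ t₂ := by
      intro i
      by_cases hpi : pA i
      · obtain ⟨μ, hμ⟩ := hpi
        have hsx : i.1.1 i.1.2 = -1 := by rw [hμ]; simp [hLead]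
        have hμ2 : i.1.2 = μ := by rw [hμ]
        rw [if_pos hsx, hμ2, ← hμ, inv_mul_cancel]
        simp [frobNorm_zero, ht₂]
      · have h := (Set.mem_univ_pi.1 hAR) ⟨i, hpi⟩
        simp only [hskA, hΦA, hcA, heA_def, MeasurableEquiv.piEquivPiSubtypeProd_apply] at h
        exact h
    -- slices
    have hr : ∀ (j : Fin (2 * L - 1)) (e : Edge 3 L), frobNorm ((((glue w e)⁻¹ * r j e : SU2) : Matrix (Fin 2) (Fin 2) ℂ) - 1) ≤ t₂ :=
      fun j e => (Set.mem_univ_pi.1 ((Set.mem_univ_pi.1 hBx) j)) e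
    -- seam
    have hg : ∀ x, frobNorm ((((g 0)⁻¹ * g x : SU2) : Matrix (Fin 2) (Fin 2) ℂ) - 1) ≤ t₂ := by
      intro x
      by_cases hx0 : x = 0
      · subst hx0; rw [inv_mul_cancel]; simp [frobNorm_zero, ht₂]
      · exact (Set.mem_univ_pi.1 hCR) ⟨x, fun h => hx0 ((hpC x).1 h)⟩
    exact swapRingDeficit_le_of_commBox ht₂ hs w r g hCC hcC hw hr hg
  /- (3) assemble in real numbers -/
  haveI : IsProbabilityMeasure (μA.prod (μB.prod μC)) := by
    rw [hμA, hμB, hμC]; infer_instance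
  rw [measureReal_swapDeficit_le_eq_fix]
  calc π4.real E * ballVol t₂ ^ (6 * L ^ 4 - 3)
      = ((μA.prod (μB.prod μC)) P).toReal := by
        rw [hPmass, ENNReal.toReal_mul, ENNReal.toReal_pow]; rfl
    _ ≤ _ := by
        rw [← measureReal_def]
        exact measureReal_mono hPsub (measure_ne_top _ _)

end Summit.QuantumFields.YangMills.Theorems.SwapVirialDeficit.SwapRing

end
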